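import Mathlib.Topology.ContinuousMap.Bounded.ArzelaAscoli
import Mathlib.Topology.MetricSpace.Equicontinuity
import Mathlib.Analysis.SpecialFunctions.Log.Basic
import Literature.Analysis.FunctionSpaces.TorusMollifier
import HarnessLib

/-!
# The Kantorovich–Rubinstein distance with logarithmic cost on the flat torus (dual form)

Analysis/FunctionSpaces support file (everything proved). It serves the discharge of the named
facts `Literature.Analysis.FluidPDE.Seis2022_rmk1_L2` / `Seis2022_thm2_L2`
(`FluidPDE/SeisDissipationRateBound`: Seis, *Bounds on the rate of enhanced dissipation*,
Comm. Math. Phys. 399 (2023) = arXiv:2003.08794, Thm. 2 and Rmk. 1), whose printed proof (§2.2)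
runs on the Kantorovich–Rubinstein distance with logarithmic cost
`D_δ(θ) = inf_{π ∈ Π(θ⁺,θ⁻)} ∫∫ log(|x-y|/δ + 1) dπ(x,y)` of a mean-zero function `θ`
(Seis 2022, §2.2 p. 6; introduced in Brenier–Otto–Seis 2011 / Seis 2017).

Since `c_δ(x,y) = log(1 + dist(x,y)/δ)` is a concave increasing function of a metric vanishing at
`0`, it is itself a metric on `T^d`, and by the Kantorovich–Rubinstein theorem `D_δ(θ)` equals
`sup { ∫ θ ζ : ζ 1-Lipschitz for c_δ }`. Mathlib has no optimal transport, so this file takes the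
**dual expression as the definition** (`Torus.krLogDist`) and develops, without any duality
theory, exactly the properties the dissipation-rate proof consumes:

* `Torus.logCost` — the cost `c_δ(x,y) = log(1 + dist x y / δ)` (torus = quotient sup metric):
  a metric dominated by `dist/δ` and by `log(1 + 1/(2δ))` (`dist ≤ 1/2` on `T^d`), with the
  concavity increment `log(1+(r+s)/δ) ≤ log(1+r/δ) + s/(δ+r)`;
* `Torus.IsLogLipschitz δ ζ` — `ζ x - ζ y ≤ c_δ(x,y)`; such `ζ` are `δ⁻¹`-Lipschitz, continuous,
  with oscillation `≤ log(1 + 1/(2δ))`;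
* `Torus.krLogDist δ θ = ⨆_{ζ log-Lipschitz} ∫ θ ζ` — for integrable mean-zero `θ`:
  `∫ θ ζ ≤ krLogDist`, `0 ≤ krLogDist δ θ ≤ log(1 + 1/(2δ)) ‖θ‖_{L¹}` (the "brutal estimate" of
  Seis 2022, §2.2 p. 8), invariance under a.e. modification of `θ`;
* **the envelope lemma** (`Torus.exists_isLogLipschitz_envelope`): if `f x - f y ≤ c_δ(x,y) +
  Φ x + Φ y` on a set `G`, then `x ↦ inf_{y ∈ G} (f y + Φ y + c_δ(x,y))` is log-Lipschitz and
  within `Φ` of `f` on `G`; hence `∫ θ f ≤ krLogDist δ θ + ∫ |θ| Φ` when `G` has full measure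
  (`Torus.integral_mul_le_krLogDist_add`) — the dual substitute for "split an arbitrary transport
  plan" in the printed proofs of Seis 2022, Lemmas 3–4;
* **existence of an optimal potential** (`Torus.exists_isLogLipschitz_integral_eq_krLogDist`):
  the supremum is attained, by Arzelà–Ascoli (Mathlib `BoundedContinuousFunction.arzela_ascoli₂`)
  on the closed, equicontinuous, uniformly bounded set of normalised log-Lipschitz functions.

## Mathlib / tree search

Mathlib (this pin): no Kantorovich/Wasserstein distance, no optimal transport (searched
`Kantorovich`, `Wasserstein`, `optimal transport`, `coupling` under `Mathlib/MeasureTheory`,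
`Mathlib/Probability`: only couplings of kernels, nothing metric). Tree: nothing on `T^d`
(`lean search -i kantorovich|wasserstein`: lattice-model Dobrushin metrics only).

## References

* C. Seis, *Bounds on the rate of enhanced dissipation*, Comm. Math. Phys. 399 (2023), 2071–2081
  (arXiv:2003.08794), §2.2 (definition of `D_δ`, p. 6; brutal estimate, p. 8). [`Seis2022`]
* C. Villani, *Topics in Optimal Transportation* (AMS, 2003), Thm. 1.14 (Kantorovich–Rubinstein
  duality; motivates the dual definition, not used).
-/

noncomputable section

open MeasureTheory Set Filter Metric
open scoped Topology BoundedContinuousFunction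

namespace Literature.Analysis.FunctionSpaces

namespace Torus

variable {d : Type*} [Fintype d]

/-! ## The logarithmic cost -/

/-- **Concavity increment of the logarithmic cost profile**: for `δ > 0`, `r, s ≥ 0`,
`log(1 + (r+s)/δ) ≤ log(1 + r/δ) + s/(δ + r)` (`log(1 + (r+s)/δ) - log(1 + r/δ) =
log(1 + s/(δ+r)) ≤ s/(δ+r)`). [folklore] -/
theorem log_one_add_div_add_le {δ r s : ℝ} (hδ : 0 < δ) (hr : 0 ≤ r) (hs : 0 ≤ s) :
    Real.log (1 + (r + s) / δ) ≤ Real.log (1 + r / δ) + s / (δ + r) := by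
  have hδr : 0 < δ + r := by positivity
  have h1 : 0 < 1 + r / δ := by positivity
  have e : 1 + (r + s) / δ = (1 + r / δ) * (1 + s / (δ + r)) := by
    field_simp
    ring
  rw [e, Real.log_mul h1.ne' (by positivity)]
  gcongr
  have h2 : 0 < 1 + s / (δ + r) := by positivity
  linarith [Real.log_le_sub_one_of_pos h2]

/-- The logarithmic transport cost on the flat torus, `c_δ(x, y) = log(1 + dist(x,y)/δ)`
(Seis 2022, §2.2: `log(|x-y|/δ + 1)`; here `dist` is the quotient sup metric of
`UnitAddTorus d = d → AddCircle 1`, equivalent to the Euclidean one up to `√d`).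
[cite: Seis2022, §2.2 (p. 6)] -/
def logCost (δ : ℝ) (x y : UnitAddTorus d) : ℝ :=
  Real.log (1 + dist x y / δ)

/-- Unfolding `logCost`. [folklore] -/
theorem logCost_def (δ : ℝ) (x y : UnitAddTorus d) : logCost δ x y = Real.log (1 + dist x y / δ) :=
  rfl

/-- `c_δ(x, x) = 0`. [folklore] -/
@[simp]
theorem logCost_self (δ : ℝ) (x : UnitAddTorus d) : logCost δ x x = 0 := by
  simp [logCost]

/-- `c_δ` is symmetric. [folklore] -/
theorem logCost_comm (δ : ℝ) (x y : UnitAddTorus d) : logCost δ x y = logCost δ y x := by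
  rw [logCost, logCost, dist_comm]

/-- `c_δ ≥ 0` for `δ > 0`. [folklore] -/
theorem logCost_nonneg {δ : ℝ} (hδ : 0 < δ) (x y : UnitAddTorus d) : 0 ≤ logCost δ x y :=
  Real.log_nonneg (le_add_of_nonneg_right (div_nonneg dist_nonneg hδ.le))

/-- `c_δ(x,y) ≤ dist(x,y)/δ` (`log(1+t) ≤ t`). [folklore] -/
theorem logCost_le_dist_div {δ : ℝ} (hδ : 0 < δ) (x y : UnitAddTorus d) :
    logCost δ x y ≤ dist x y / δ := by
  have h : 0 < 1 + dist x y / δ := by positivity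
  have := Real.log_le_sub_one_of_pos h
  rw [logCost]
  linarith

/-- **Triangle inequality** for the logarithmic cost: `c_δ(x,z) ≤ c_δ(x,y) + c_δ(y,z)`
(`1 + (a+b)/δ ≤ (1 + a/δ)(1 + b/δ)`), i.e. `c_δ` is a metric. [folklore] -/
theorem logCost_triangle {δ : ℝ} (hδ : 0 < δ) (x y z : UnitAddTorus d) :
    logCost δ x z ≤ logCost δ x y + logCost δ y z := by
  have ha : 0 ≤ dist x y / δ := div_nonneg dist_nonneg hδ.le
  have hb : 0 ≤ dist y z / δ := div_nonneg dist_nonneg hδ.le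
  rw [logCost, logCost, logCost, ← Real.log_mul (by positivity) (by positivity)]
  refine Real.log_le_log (by positivity) ?_
  have htri : dist x z / δ ≤ dist x y / δ + dist y z / δ := by
    rw [← add_div]
    exact div_le_div_of_nonneg_right (dist_triangle x y z) hδ.le
  nlinarith [mul_nonneg ha hb]

/-- `c_δ(x,y) ≤ log(1 + 1/(2δ))`: the torus has diameter `≤ 1/2`. [folklore] -/
theorem logCost_le_log {δ : ℝ} (hδ : 0 < δ) (x y : UnitAddTorus d) :
    logCost δ x y ≤ Real.log (1 + 1 / (2 * δ)) := by
  refine Real.log_le_log (by positivity) ?_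
  have h := dist_le_half x y
  have : dist x y / δ ≤ 1 / (2 * δ) := by
    rw [div_le_div_iff₀ hδ (by positivity)]
    nlinarith
  linarith

/-- The bound `log(1 + 1/(2δ))` is nonnegative. [folklore] -/
theorem log_one_add_inv_two_mul_nonneg {δ : ℝ} (hδ : 0 < δ) : 0 ≤ Real.log (1 + 1 / (2 * δ)) :=
  Real.log_nonneg (le_add_of_nonneg_right (by positivity))

/-- Concavity increment on the torus: if `dist x' y' ≤ dist x y + s` then
`c_δ(x',y') ≤ c_δ(x,y) + s/(δ + dist x y)`. [folklore] -/
theorem logCost_le_logCost_add_div {δ : ℝ} (hδ : 0 < δ) {x y x' y' : UnitAddTorus d} {s : ℝ}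
    (hs : 0 ≤ s) (h : dist x' y' ≤ dist x y + s) :
    logCost δ x' y' ≤ logCost δ x y + s / (δ + dist x y) := by
  have h1 : logCost δ x' y' ≤ Real.log (1 + (dist x y + s) / δ) := by
    refine Real.log_le_log (by positivity) ?_
    gcongr
  exact h1.trans (log_one_add_div_add_le hδ dist_nonneg hs)

/-! ## Log-Lipschitz functions -/

/-- `ζ` is `1`-Lipschitz for the logarithmic cost: `ζ x - ζ y ≤ c_δ(x,y)` for all `x, y` (the
admissible potentials of the Kantorovich–Rubinstein dual problem for the metric `c_δ`;
Villani 2003, Thm. 1.14). [folklore] -/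
def IsLogLipschitz (δ : ℝ) (ζ : UnitAddTorus d → ℝ) : Prop :=
  ∀ x y, ζ x - ζ y ≤ logCost δ x y

namespace IsLogLipschitz

variable {δ : ℝ} {ζ : UnitAddTorus d → ℝ}

/-- Constants are log-Lipschitz (for `δ > 0`). [folklore] -/
theorem const (hδ : 0 < δ) (c : ℝ) : IsLogLipschitz δ (fun _ : UnitAddTorus d => c) :=
  fun x y => by simpa using logCost_nonneg hδ x y

/-- Log-Lipschitz functions are stable under adding constants. [folklore] -/
theorem add_const (h : IsLogLipschitz δ ζ) (c : ℝ) : IsLogLipschitz δ (fun x => ζ x + c) :=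
  fun x y => by simpa using h x y

/-- Log-Lipschitz functions are stable under subtracting constants. [folklore] -/
theorem sub_const (h : IsLogLipschitz δ ζ) (c : ℝ) : IsLogLipschitz δ (fun x => ζ x - c) :=
  fun x y => by simpa using h x y

/-- Two-sided form: `|ζ x - ζ y| ≤ c_δ(x,y)`. [folklore] -/
theorem abs_sub_le (h : IsLogLipschitz δ ζ) (x y : UnitAddTorus d) : |ζ x - ζ y| ≤ logCost δ x y := by
  rw [abs_sub_le_iff]
  exact ⟨h x y, by rw [logCost_comm]; exact h y x⟩

/-- A log-Lipschitz function is `δ⁻¹`-Lipschitz for the torus metric. [folklore] -/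
theorem dist_le (hδ : 0 < δ) (h : IsLogLipschitz δ ζ) (x y : UnitAddTorus d) :
    dist (ζ x) (ζ y) ≤ δ⁻¹ * dist x y := by
  rw [Real.dist_eq, inv_mul_eq_div]
  exact (h.abs_sub_le x y).trans (logCost_le_dist_div hδ x y)

/-- A log-Lipschitz function is `δ⁻¹`-Lipschitz for the torus metric. [folklore] -/
theorem lipschitzWith (hδ : 0 < δ) (h : IsLogLipschitz δ ζ) : LipschitzWith (Real.toNNReal δ⁻¹) ζ :=
  LipschitzWith.of_dist_le_mul fun x y => by
    rw [Real.coe_toNNReal _ (inv_nonneg.2 hδ.le)]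
    exact h.dist_le hδ x y

/-- Log-Lipschitz functions are continuous. [folklore] -/
theorem continuous (hδ : 0 < δ) (h : IsLogLipschitz δ ζ) : Continuous ζ :=
  (h.lipschitzWith hδ).continuous

/-- Oscillation bound: `|ζ x - ζ y| ≤ log(1 + 1/(2δ))`. [folklore] -/
theorem abs_sub_le_log (hδ : 0 < δ) (h : IsLogLipschitz δ ζ) (x y : UnitAddTorus d) :
    |ζ x - ζ y| ≤ Real.log (1 + 1 / (2 * δ)) :=
  (h.abs_sub_le x y).trans (logCost_le_log hδ x y)

/-- Uniform bound: `|ζ x| ≤ |ζ 0| + log(1 + 1/(2δ))`. [folklore] -/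
theorem abs_le (hδ : 0 < δ) (h : IsLogLipschitz δ ζ) (x : UnitAddTorus d) :
    |ζ x| ≤ |ζ 0| + Real.log (1 + 1 / (2 * δ)) := by
  have := h.abs_sub_le_log hδ x 0
  have e : ζ x = ζ 0 + (ζ x - ζ 0) := by ring
  rw [e]
  exact (abs_add_le _ _).trans (by gcongr)

/-- `θ ζ` is integrable for integrable `θ` and log-Lipschitz `ζ`. [folklore] -/
theorem integrable_mul (hδ : 0 < δ) (h : IsLogLipschitz δ ζ) {θ : UnitAddTorus d → ℝ}
    (hθ : Integrable θ volume) : Integrable (fun x => θ x * ζ x) volume :=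
  hθ.mul_bdd (h.continuous hδ).aestronglyMeasurable
    (Eventually.of_forall fun x => by simpa [Real.norm_eq_abs] using h.abs_le hδ x)

end IsLogLipschitz

/-! ## The dual Kantorovich–Rubinstein distance with logarithmic cost -/

/-- **The Kantorovich–Rubinstein distance with logarithmic cost, dual form**:
`krLogDist δ θ = sup { ∫ θ ζ : ζ x - ζ y ≤ log(1 + dist(x,y)/δ) }`. For mean-zero `θ ∈ L¹(T^d)`
this is, by Kantorovich–Rubinstein duality for the metric `c_δ` (Villani 2003, Thm. 1.14), the
distance `D_δ(θ) = inf_{π ∈ Π(θ⁺,θ⁻)} ∫∫ log(|x-y|/δ+1) dπ` of Seis 2022, §2.2 (p. 6); the tree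
takes the dual expression as the definition. **Junk:** the real supremum `⨆` is `0` when the
integrals are unbounded above (e.g. `∫ θ ≠ 0`). [cite: Seis2022, §2.2 (p. 6)] -/
def krLogDist (δ : ℝ) (θ : UnitAddTorus d → ℝ) : ℝ :=
  ⨆ ζ : {ζ : UnitAddTorus d → ℝ // IsLogLipschitz δ ζ}, ∫ x, θ x * (ζ : UnitAddTorus d → ℝ) x

/-- The admissible class is nonempty (it contains `0`) for `δ > 0`. [folklore] -/
theorem nonempty_isLogLipschitz {δ : ℝ} (hδ : 0 < δ) :
    Nonempty {ζ : UnitAddTorus d → ℝ // IsLogLipschitz δ ζ} :=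
  ⟨⟨fun _ => 0, IsLogLipschitz.const hδ 0⟩⟩

/-- **The brutal estimate, for each potential**: for mean-zero `θ ∈ L¹` and log-Lipschitz `ζ`,
`∫ θ ζ ≤ log(1 + 1/(2δ)) ∫ |θ|` (`∫ θ ζ = ∫ θ (ζ - ζ 0)` and `|ζ - ζ 0| ≤ log(1 + 1/(2δ))`;
Seis 2022, §2.2 p. 8, "`D_δ(θ) ≤ log(1/δ+1) ∫∫ dπ ≲ log(1/δ+1) ‖θ‖_{L¹}`"). [cite: Seis2022, §2.2 (p. 8)] -/
theorem integral_mul_le_log_mul_integral_abs {δ : ℝ} (hδ : 0 < δ) {θ : UnitAddTorus d → ℝ}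
    (hθ : Integrable θ volume) (h0 : ∫ x, θ x = 0) {ζ : UnitAddTorus d → ℝ} (hζ : IsLogLipschitz δ ζ) :
    ∫ x, θ x * ζ x ≤ Real.log (1 + 1 / (2 * δ)) * ∫ x, |θ x| := by
  have hi := hζ.integrable_mul hδ hθ
  have hi' : Integrable (fun x => θ x * (ζ x - ζ 0)) volume := by
    simp_rw [mul_sub]
    exact hi.sub (hθ.mul_const _)
  have e : ∫ x, θ x * ζ x = ∫ x, θ x * (ζ x - ζ 0) := by
    simp_rw [mul_sub]
    rw [integral_sub hi (hθ.mul_const _), integral_mul_const, h0, zero_mul, sub_zero]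
  rw [e, ← integral_const_mul]
  refine integral_mono hi' (hθ.abs.const_mul _) fun x => ?_
  show θ x * (ζ x - ζ 0) ≤ Real.log (1 + 1 / (2 * δ)) * |θ x|
  calc θ x * (ζ x - ζ 0) ≤ |θ x * (ζ x - ζ 0)| := le_abs_self _
    _ = |θ x| * |ζ x - ζ 0| := abs_mul _ _
    _ ≤ |θ x| * Real.log (1 + 1 / (2 * δ)) :=
        mul_le_mul_of_nonneg_left (hζ.abs_sub_le_log hδ x 0) (abs_nonneg _)
    _ = _ := mul_comm _ _

/-- The dual functional is bounded above on the admissible class (mean-zero `θ ∈ L¹`). [folklore] -/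
theorem bddAbove_range_integral_mul {δ : ℝ} (hδ : 0 < δ) {θ : UnitAddTorus d → ℝ}
    (hθ : Integrable θ volume) (h0 : ∫ x, θ x = 0) :
    BddAbove (Set.range fun ζ : {ζ : UnitAddTorus d → ℝ // IsLogLipschitz δ ζ} =>
      ∫ x, θ x * (ζ : UnitAddTorus d → ℝ) x) :=
  ⟨Real.log (1 + 1 / (2 * δ)) * ∫ x, |θ x|, by
    rintro _ ⟨ζ, rfl⟩
    exact integral_mul_le_log_mul_integral_abs hδ hθ h0 ζ.2⟩

/-- **Weak duality direction**: `∫ θ ζ ≤ krLogDist δ θ` for every log-Lipschitz `ζ`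
(mean-zero `θ ∈ L¹`). [folklore] -/
theorem integral_mul_le_krLogDist {δ : ℝ} (hδ : 0 < δ) {θ : UnitAddTorus d → ℝ}
    (hθ : Integrable θ volume) (h0 : ∫ x, θ x = 0) {ζ : UnitAddTorus d → ℝ} (hζ : IsLogLipschitz δ ζ) :
    ∫ x, θ x * ζ x ≤ krLogDist δ θ :=
  le_ciSup (bddAbove_range_integral_mul hδ hθ h0) ⟨ζ, hζ⟩

/-- `0 ≤ krLogDist δ θ` for mean-zero `θ ∈ L¹` (test with `ζ = 0`). [folklore] -/
theorem krLogDist_nonneg {δ : ℝ} (hδ : 0 < δ) {θ : UnitAddTorus d → ℝ}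
    (hθ : Integrable θ volume) (h0 : ∫ x, θ x = 0) : 0 ≤ krLogDist δ θ := by
  simpa using integral_mul_le_krLogDist hδ hθ h0 (IsLogLipschitz.const hδ 0)

/-- **The brutal estimate** (Seis 2022, §2.2 p. 8): `krLogDist δ θ ≤ log(1 + 1/(2δ)) ∫ |θ|`
for mean-zero `θ ∈ L¹(T^d)`. [cite: Seis2022, §2.2 (p. 8)] -/
theorem krLogDist_le {δ : ℝ} (hδ : 0 < δ) {θ : UnitAddTorus d → ℝ}
    (hθ : Integrable θ volume) (h0 : ∫ x, θ x = 0) :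
    krLogDist δ θ ≤ Real.log (1 + 1 / (2 * δ)) * ∫ x, |θ x| :=
  haveI : Nonempty {ζ : UnitAddTorus d → ℝ // IsLogLipschitz δ ζ} := nonempty_isLogLipschitz hδ
  ciSup_le fun ζ => integral_mul_le_log_mul_integral_abs hδ hθ h0 ζ.2

/-- `krLogDist` only depends on the a.e. class of `θ`. [folklore] -/
theorem krLogDist_congr_ae {δ : ℝ} {θ θ' : UnitAddTorus d → ℝ} (h : θ =ᵐ[volume] θ') :
    krLogDist δ θ = krLogDist δ θ' := by
  unfold krLogDist
  congr 1
  funext ζ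
  exact integral_congr_ae (h.mono fun x hx => by simp only [hx])

/-! ## The envelope lemma -/

/-- **Envelope lemma.** If `f x - f y ≤ c_δ(x,y) + Φ x + Φ y` for all `x, y` in a nonempty set
`G`, then there is a log-Lipschitz `g` with `f - Φ ≤ g ≤ f + Φ` on `G`, namely
`g x = inf_{y ∈ G} (f y + Φ y + c_δ(x,y))` (an infimum of `c_δ`-Lipschitz functions). This is
the dual counterpart of splitting a transport plan in the printed proofs of Seis 2022,
Lemmas 3–4. [folklore] -/
theorem exists_isLogLipschitz_envelope {δ : ℝ} (hδ : 0 < δ) {f Φ : UnitAddTorus d → ℝ}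
    {G : Set (UnitAddTorus d)} (hG : G.Nonempty)
    (h : ∀ x ∈ G, ∀ y ∈ G, f x - f y ≤ logCost δ x y + Φ x + Φ y) :
    ∃ g : UnitAddTorus d → ℝ, IsLogLipschitz δ g ∧
      ∀ x ∈ G, f x - Φ x ≤ g x ∧ g x ≤ f x + Φ x := by
  obtain ⟨x₀, hx₀⟩ := hG
  set L := Real.log (1 + 1 / (2 * δ)) with hL
  -- the candidate: `g x = inf_{y ∈ G} (f y + Φ y + c(x,y))`
  set S : UnitAddTorus d → Set ℝ := fun x => (fun y => f y + Φ y + logCost δ x y) '' G with hS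
  have hne : ∀ x, (S x).Nonempty := fun x => ⟨_, x₀, hx₀, rfl⟩
  have hlow : ∀ x, ∀ r ∈ S x, f x₀ - Φ x₀ - L ≤ r := by
    rintro x _ ⟨y, hy, rfl⟩
    have h1 := h x₀ hx₀ y hy
    have h2 := logCost_le_log hδ x₀ y
    have h3 := logCost_nonneg hδ x y
    linarith
  have hbdd : ∀ x, BddBelow (S x) := fun x => ⟨_, hlow x⟩
  refine ⟨fun x => sInf (S x), fun x x' => ?_, fun x hx => ⟨?_, ?_⟩⟩
  · -- log-Lipschitz: `g x ≤ f y + Φ y + c(x',y) + c(x,x')` for all `y ∈ G`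
    show sInf (S x) - sInf (S x') ≤ logCost δ x x'
    have key : sInf (S x) - logCost δ x x' ≤ sInf (S x') := by
      refine le_csInf (hne x') ?_
      rintro _ ⟨y, hy, rfl⟩
      rw [sub_le_iff_le_add']
      calc sInf (S x) ≤ f y + Φ y + logCost δ x y := csInf_le (hbdd x) ⟨y, hy, rfl⟩
        _ ≤ f y + Φ y + (logCost δ x x' + logCost δ x' y) := by
            gcongr
            exact logCost_triangle hδ x x' y
        _ = logCost δ x x' + (f y + Φ y + logCost δ x' y) := by ring
    linarith
  · show f x - Φ x ≤ sInf (S x)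
    refine le_csInf (hne x) ?_
    rintro _ ⟨y, hy, rfl⟩
    have := h x hx y hy
    linarith
  · show sInf (S x) ≤ f x + Φ x
    calc sInf (S x) ≤ f x + Φ x + logCost δ x x := csInf_le (hbdd x) ⟨x, hx, rfl⟩
      _ = f x + Φ x := by rw [logCost_self, add_zero]

/-- **Integral form of the envelope lemma.** For mean-zero `θ ∈ L¹(T^d)`: if
`f x - f y ≤ c_δ(x,y) + Φ x + Φ y` for all `x, y` in a set `G` of full measure, `θ f ∈ L¹` and
`|θ| Φ ∈ L¹`, then `∫ θ f ≤ krLogDist δ θ + ∫ |θ| Φ`. (With an optimal plan `π` this would read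
`∫ θ f = ∫∫ (f x - f y) dπ ≤ ∫∫ c_δ dπ + ∫ (θ⁺ + θ⁻) Φ`; Seis 2022, proofs of Lemmas 3–4.) [folklore] -/
theorem integral_mul_le_krLogDist_add {δ : ℝ} (hδ : 0 < δ) {θ : UnitAddTorus d → ℝ}
    (hθ : Integrable θ volume) (h0 : ∫ x, θ x = 0) {f Φ : UnitAddTorus d → ℝ}
    {G : Set (UnitAddTorus d)} (hG : ∀ᵐ x ∂volume, x ∈ G)
    (h : ∀ x ∈ G, ∀ y ∈ G, f x - f y ≤ logCost δ x y + Φ x + Φ y)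
    (hf : Integrable (fun x => θ x * f x) volume) (hΦ : Integrable (fun x => |θ x| * Φ x) volume) :
    ∫ x, θ x * f x ≤ krLogDist δ θ + ∫ x, |θ x| * Φ x := by
  have hGne : G.Nonempty := by
    by_contra hc
    rw [Set.not_nonempty_iff_eq_empty] at hc
    rw [hc] at hG
    simp only [mem_empty_iff_false, eventually_false_iff_eq_bot, ae_eq_bot] at hG
    exact (NeZero.ne (volume : Measure (UnitAddTorus d))) hG
  obtain ⟨g, hg, hfg⟩ := exists_isLogLipschitz_envelope hδ hGne h
  have hgi := hg.integrable_mul hδ hθ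
  have h1 : (∫ x, θ x * f x) - ∫ x, θ x * g x ≤ ∫ x, |θ x| * Φ x := by
    have key : ∫ x, (θ x * f x - θ x * g x) ≤ ∫ x, |θ x| * Φ x := by
      refine integral_mono_ae (hf.sub hgi) hΦ ?_
      filter_upwards [hG] with x hx
      have hb := hfg x hx
      have : |f x - g x| ≤ Φ x := abs_sub_le_iff.2 ⟨by linarith [hb.1], by linarith [hb.2]⟩
      calc θ x * f x - θ x * g x = θ x * (f x - g x) := by ring
        _ ≤ |θ x * (f x - g x)| := le_abs_self _
        _ = |θ x| * |f x - g x| := abs_mul _ _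
        _ ≤ |θ x| * Φ x := mul_le_mul_of_nonneg_left this (abs_nonneg _)
    rwa [integral_sub hf hgi] at key
  have h2 := integral_mul_le_krLogDist hδ hθ h0 hg
  linarith

/-! ## Existence of an optimal potential (Arzelà–Ascoli) -/

/-- The normalised admissible potentials as bounded continuous functions:
`{F : T^d →ᵇ ℝ | F log-Lipschitz, F 0 = 0}`. [folklore] -/
def logLipschitzBCF (δ : ℝ) : Set (UnitAddTorus d →ᵇ ℝ) :=
  {F | IsLogLipschitz δ (F : UnitAddTorus d → ℝ) ∧ F 0 = 0}

/-- The normalised admissible class is closed in `T^d →ᵇ ℝ` (pointwise conditions). [folklore] -/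
theorem isClosed_logLipschitzBCF (δ : ℝ) : IsClosed (logLipschitzBCF (d := d) δ) := by
  have e : logLipschitzBCF (d := d) δ =
      (⋂ x, ⋂ y, {F : UnitAddTorus d →ᵇ ℝ | F x - F y ≤ logCost δ x y}) ∩ {F | F 0 = 0} := by
    ext F
    simp only [logLipschitzBCF, IsLogLipschitz, mem_inter_iff, mem_setOf_eq, mem_iInter]
  rw [e]
  refine IsClosed.inter (isClosed_iInter fun x => isClosed_iInter fun y => ?_) ?_
  · exact isClosed_le ((continuous_eval_const x).sub
      (continuous_eval_const y)) continuous_const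
  · exact isClosed_eq (continuous_eval_const 0) continuous_const

/-- **Compactness of the normalised admissible class** (Arzelà–Ascoli: closed, values in
`[-log(1+1/(2δ)), log(1+1/(2δ))]`, common continuity modulus `t ↦ t/δ`). [folklore] -/
theorem isCompact_logLipschitzBCF {δ : ℝ} (hδ : 0 < δ) : IsCompact (logLipschitzBCF (d := d) δ) := by
  set L := Real.log (1 + 1 / (2 * δ))
  refine BoundedContinuousFunction.arzela_ascoli₂ (Icc (-L) L) isCompact_Icc _
    (isClosed_logLipschitzBCF δ) (fun F x hF => ?_) ?_
  · have h := hF.1.abs_sub_le_log hδ x 0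
    rw [hF.2, sub_zero] at h
    exact ⟨neg_le_of_abs_le h, le_of_abs_le h⟩
  · refine Metric.equicontinuous_of_continuity_modulus (fun t => δ⁻¹ * t) ?_ _ ?_
    · have : Tendsto (fun t : ℝ => δ⁻¹ * t) (𝓝 0) (𝓝 (δ⁻¹ * 0)) := tendsto_id.const_mul _
      simpa using this
    · rintro x y ⟨F, hF⟩
      exact hF.1.dist_le hδ x y

/-- The dual functional `F ↦ ∫ θ F` is Lipschitz (constant `‖θ‖_{L¹}`) on `T^d →ᵇ ℝ`. [folklore] -/
theorem lipschitzWith_integral_mul_bcf {θ : UnitAddTorus d → ℝ} (hθ : Integrable θ volume) :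
    LipschitzWith (Real.toNNReal (∫ x, |θ x|))
      (fun F : UnitAddTorus d →ᵇ ℝ => ∫ x, θ x * F x) := by
  refine LipschitzWith.of_dist_le_mul fun F G => ?_
  have hiF : Integrable (fun x => θ x * F x) volume :=
    hθ.mul_bdd F.continuous.aestronglyMeasurable
      (Eventually.of_forall fun x => BoundedContinuousFunction.norm_coe_le_norm F x)
  have hiG : Integrable (fun x => θ x * G x) volume :=
    hθ.mul_bdd G.continuous.aestronglyMeasurable
      (Eventually.of_forall fun x => BoundedContinuousFunction.norm_coe_le_norm G x)
  rw [Real.dist_eq, ← integral_sub hiF hiG, Real.coe_toNNReal _ (integral_nonneg fun x => abs_nonneg _),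
    ← integral_mul_const]
  refine abs_integral_le_integral_abs.trans (integral_mono_of_nonneg
    (Eventually.of_forall fun x => abs_nonneg _) (hθ.abs.mul_const _) (Eventually.of_forall fun x => ?_))
  show |θ x * F x - θ x * G x| ≤ |θ x| * dist F G
  rw [← mul_sub, abs_mul]
  refine mul_le_mul_of_nonneg_left ?_ (abs_nonneg _)
  rw [← Real.dist_eq]
  exact BoundedContinuousFunction.dist_coe_le_dist x

/-- **Existence of an optimal Kantorovich potential.** For `δ > 0` and mean-zero `θ ∈ L¹(T^d)`
there is a log-Lipschitz `ζ` with `ζ 0 = 0` attaining the supremum: `∫ θ ζ = krLogDist δ θ`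
(maximise the continuous functional `F ↦ ∫ θ F` over the compact normalised class; general
admissible `ζ` reduce to it by subtracting `ζ 0`, which does not change `∫ θ ζ`). [folklore] -/
theorem exists_isLogLipschitz_integral_eq_krLogDist {δ : ℝ} (hδ : 0 < δ) {θ : UnitAddTorus d → ℝ}
    (hθ : Integrable θ volume) (h0 : ∫ x, θ x = 0) :
    ∃ ζ : UnitAddTorus d → ℝ, IsLogLipschitz δ ζ ∧ ζ 0 = 0 ∧ ∫ x, θ x * ζ x = krLogDist δ θ := by
  have h0A : (0 : UnitAddTorus d →ᵇ ℝ) ∈ logLipschitzBCF (d := d) δ :=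
    ⟨fun x y => by simpa using logCost_nonneg hδ x y, rfl⟩
  obtain ⟨F, hFA, hmax⟩ := (isCompact_logLipschitzBCF (d := d) hδ).exists_isMaxOn ⟨0, h0A⟩
    (lipschitzWith_integral_mul_bcf hθ).continuous.continuousOn
  refine ⟨F, hFA.1, hFA.2, le_antisymm (integral_mul_le_krLogDist hδ hθ h0 hFA.1) ?_⟩
  haveI : Nonempty {ζ : UnitAddTorus d → ℝ // IsLogLipschitz δ ζ} := nonempty_isLogLipschitz hδ
  refine ciSup_le fun ζ => ?_
  -- normalise `ζ` and view it as a bounded continuous function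
  have hζc : Continuous fun x => (ζ : UnitAddTorus d → ℝ) x - (ζ : UnitAddTorus d → ℝ) 0 :=
    (ζ.2.continuous hδ).sub continuous_const
  set Z : UnitAddTorus d →ᵇ ℝ := BoundedContinuousFunction.mkOfCompact ⟨_, hζc⟩ with hZ
  have hZA : Z ∈ logLipschitzBCF (d := d) δ := ⟨ζ.2.sub_const _, by simp [hZ]⟩
  have hi := ζ.2.integrable_mul hδ hθ
  have e : ∫ x, θ x * (ζ : UnitAddTorus d → ℝ) x = ∫ x, θ x * Z x := by
    simp only [hZ, BoundedContinuousFunction.mkOfCompact_apply, ContinuousMap.coe_mk, mul_sub]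
    rw [integral_sub hi (hθ.mul_const _), integral_mul_const, h0, zero_mul, sub_zero]
  rw [e]
  exact hmax hZA

end Torus

end Literature.Analysis.FunctionSpaces
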